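import Mathlib
import HarnessLib
import Summits.Ventures.LatticeQCDFlow.Scoring.PairAcceptanceVarianceSharp

/-!
# LatticeQCDFlow / Scoring — RIGIDITY of the acceptance-variance envelope: the hit-or-miss flows
# `p = q(· | S)` are the ONLY maximisers of `Var U` at given acceptance, at every `n ≥ 2`

HONEST FRAMING: exact (Metropolis-corrected) sampling algorithms for lattice gauge theory;
figures of merit are autocorrelation/cost numbers at stated couplings and volumes; no
continuum-physics claim.

Venture `LatticeQCDFlow` (cell pub-lqcd), sub-topic `Scoring`; FANOUT row 3 (`s0-u1-a`, S0-B
implementation A, GEN-11).  NEW WORK of the cell (elementary), closing the item "uniqueness of the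
maximiser" listed as NOT CLAIMED in row 3's `Scoring/PairAcceptanceVarianceSharp` (GEN-8, imported)
and `Scoring/AllPairsAcceptanceVarianceSharpness` (GEN-10); NO definition is introduced.

## Setting (finite `X`; target `p ≥ 0` and model `q > 0` normalised; `w = p/q`; `n ≥ 2` i.i.d.
## proposals with law `blockProd (fun _ ↦ q)`; `U = Σ_{i≠j} min(w_i, w_j)/(n(n−1))`, `E U = a = acc(p, q)`;
## `h₁(x) = Σ_y q_y min(w_x, w_y)`, `m₁ = Σ_x q_x h₁(x)²`, `m₂ = Σ_xΣ_y q_x q_y min(w_x, w_y)²`)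

Say the pair `(p, q)` is HIT-OR-MISS when all positive importance weights are equal:
`∀ x y, 0 < p x → 0 < p y → w_x = w_y` — equivalently (`hitOrMiss_iff_eq_condModel`) the target is
the model conditioned on a set, `p = q·𝟙_S / q(S)` (`S` = the support of `p`; every proposal is
either an exact target draw or has target weight `0`).  The imported envelope
`E[(U − a)²] ≤ (2(1 − a²) + 4(n − 2)·a(1 − a))/(n(n − 1))` (`variance_pairMin_le_sharp`) came from
Hoeffding's exact law `variance_pairMin_eq` and the two weight inequalities `m₂ ≤ 1`, `m₁ ≤ a`.

* `min_sq_eq_mul_iff` — for `u, v ≥ 0`: `min(u, v)² = u·v ↔ u = v ∨ u = 0 ∨ v = 0`;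
* `one_sub_qq_min_weight_sq_eq` — the DEFECT IDENTITY
  `1 − m₂ = Σ_xΣ_y q_x q_y (w_x w_y − min(w_x, w_y)²)`, a sum of nonnegative terms;
* **`qq_min_weight_sq_eq_one_iff`** — `m₂ = 1 ↔` hit-or-miss;
* `condMean_eq_ite_of_hitOrMiss` — for a hit-or-miss pair `h₁ = 𝟙_{p > 0}` pointwise, hence
  **`accRate_eq_modelMass_of_hitOrMiss`** `acc(p, q) = q(p > 0)`, `condMeanSq_eq_accRate_of_hitOrMiss`
  (`m₁ = a`) and **`essFrac_eq_accRate_of_hitOrMiss`** (`ESS/N = acc = q(p > 0)`: hit-or-miss flows sit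
  ON the diagonal `acc = ESS` of the acceptance-vs-ESS plane of row 3's `Scaling/AcceptanceEss*` laws);
* **`variance_pairMin_eq_sharp_iff`** — for every `n ≥ 2`:
  `E[(U − a)²] = (2(1 − a²) + 4(n − 2)·a(1 − a))/(n(n − 1)) ↔` hit-or-miss.  (`←`: `m₂ = 1`, `m₁ = a`;
  `→`: envelope `−` variance `= (2(1 − m₂) + 4(n − 2)(a − m₁))/(n(n − 1))` with both summands `≥ 0`,
  so equality forces `m₂ = 1`.)  **`variance_pairMin_lt_sharp`** — STRICT inequality for every pair
  that is not hit-or-miss;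
* `hitOrMiss_iff_eq_condModel` — hit-or-miss `↔ ∃ S, p = (q·𝟙_S)/q(S)` (with `S` the support of `p`).

Reading (value-free): among all flows with equilibrium acceptance `a`, the acceptance estimate read
off `n` fresh proposals is noisiest EXACTLY for the all-or-nothing flows whose proposals are either
perfect or worthless; any flow with two distinct positive weight values has strictly smaller variance
than the distribution-free bar `√((2(1 − a²) + 4(n − 2)a(1 − a))/(n(n − 1)))`.
NOT CLAIMED: the general-space (measure-theoretic) rigidity (a separate file); a quantitative
deficit (how far below the envelope a given non-hit-or-miss flow sits); any number of ours.
-/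

namespace Summit.Ventures.LatticeQCDFlow.Scoring

open Finset
open Literature.Probability.MarkovChains
open Summit.Ventures.LatticeQCDFlow.Exactness
open Summit.Ventures.LatticeQCDFlow.Theory2

section Rigidity

variable {X : Type*} [Fintype X] {n : ℕ}

/-! ### The pointwise equality case and the defect identity -/

omit [Fintype X] in
/-- For `u, v ≥ 0`: `min(u, v)² ≤ u·v`. [folklore] -/
theorem min_sq_le_mul {u v : ℝ} (hu : 0 ≤ u) (hv : 0 ≤ v) : min u v ^ 2 ≤ u * v := by
  rw [sq]
  exact mul_le_mul (min_le_left _ _) (min_le_right _ _) (le_min hu hv) hu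

omit [Fintype X] in
/-- For `u, v ≥ 0`: `min(u, v)² = u·v ↔ u = v ∨ u = 0 ∨ v = 0`. [folklore] -/
theorem min_sq_eq_mul_iff {u v : ℝ} (hu : 0 ≤ u) (hv : 0 ≤ v) :
    min u v ^ 2 = u * v ↔ u = v ∨ u = 0 ∨ v = 0 := by
  constructor
  · intro h
    rcases le_total u v with huv | hvu
    · rw [min_eq_left huv, sq] at h
      have : u * (v - u) = 0 := by linarith
      rcases mul_eq_zero.mp this with h0 | h0
      · exact Or.inr (Or.inl h0)
      · exact Or.inl (by linarith)
    · rw [min_eq_right hvu, sq] at h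
      have : v * (u - v) = 0 := by linarith
      rcases mul_eq_zero.mp this with h0 | h0
      · exact Or.inr (Or.inr h0)
      · exact Or.inl (by linarith)
  · rintro (h | h | h)
    · rw [h, min_self, sq]
    · rw [h, min_eq_left hv, sq, zero_mul, zero_mul]
    · rw [h, min_eq_right hu, sq, mul_zero, mul_zero]

/-- **The defect identity**: `1 − m₂ = Σ_xΣ_y q_x q_y (w_x w_y − min(w_x, w_y)²)` for a normalised
target `p` and a positive model `q` (because `Σ_xΣ_y q_x q_y w_x w_y = (E_q w)² = 1`). [ours] -/
theorem one_sub_qq_min_weight_sq_eq {p q : X → ℝ} (hq : ∀ x, 0 < q x) (hp1 : ∑ x, p x = 1) :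
    1 - ∑ x, ∑ y, q x * q y * min (weight p q x) (weight p q y) ^ 2
      = ∑ x, ∑ y, q x * q y * (weight p q x * weight p q y - min (weight p q x) (weight p q y) ^ 2) := by
  have h1 : ∑ x, ∑ y, q x * q y * (weight p q x * weight p q y) = 1 := by
    calc ∑ x, ∑ y, q x * q y * (weight p q x * weight p q y)
        = (∑ x, q x * weight p q x) * ∑ y, q y * weight p q y := by
          rw [sum_mul_sum]
          exact sum_congr rfl fun x _ => sum_congr rfl fun y _ => by ring
      _ = 1 := by rw [sum_mul_weight hq hp1, mul_one]
  rw [← h1, ← sum_sub_distrib]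
  refine sum_congr rfl fun x _ => ?_
  rw [← sum_sub_distrib]
  exact sum_congr rfl fun y _ => by ring

/-- **`m₂ = 1` iff hit-or-miss**: `Σ_xΣ_y q_x q_y min(w_x, w_y)² = 1 ↔` all positive weights are equal
(`∀ x y, 0 < p x → 0 < p y → w_x = w_y`).  (`→`: the defect is a vanishing sum of nonnegative terms,
so `min(w_x, w_y)² = w_x w_y` for all `x, y`, i.e. `w_x = w_y` unless one of them is `0`.) [ours] -/
theorem qq_min_weight_sq_eq_one_iff {p q : X → ℝ} (hp : ∀ x, 0 ≤ p x) (hq : ∀ x, 0 < q x)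
    (hp1 : ∑ x, p x = 1) :
    ∑ x, ∑ y, q x * q y * min (weight p q x) (weight p q y) ^ 2 = 1 ↔
      ∀ x y, 0 < p x → 0 < p y → weight p q x = weight p q y := by
  have hw : ∀ z, 0 ≤ weight p q z := fun z => div_nonneg (hp z) (hq z).le
  have hwpos : ∀ z, 0 < p z → 0 < weight p q z := fun z hz => div_pos hz (hq z)
  have hterm : ∀ x y, 0 ≤ q x * q y * (weight p q x * weight p q y
      - min (weight p q x) (weight p q y) ^ 2) := fun x y =>
    mul_nonneg (mul_nonneg (hq x).le (hq y).le)
      (sub_nonneg.mpr (min_sq_le_mul (hw x) (hw y)))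
  constructor
  · intro h x y hx hy
    have hD : ∑ x, ∑ y, q x * q y * (weight p q x * weight p q y
        - min (weight p q x) (weight p q y) ^ 2) = 0 := by
      rw [← one_sub_qq_min_weight_sq_eq hq hp1, h, sub_self]
    have hx0 := (sum_eq_zero_iff_of_nonneg fun x _ => sum_nonneg fun y _ => hterm x y).mp hD x
      (mem_univ x)
    have hxy := (sum_eq_zero_iff_of_nonneg fun y _ => hterm x y).mp hx0 y (mem_univ y)
    have hq0 : q x * q y ≠ 0 := (mul_pos (hq x) (hq y)).ne'
    have heq : min (weight p q x) (weight p q y) ^ 2 = weight p q x * weight p q y := by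
      rcases mul_eq_zero.mp hxy with h0 | h0
      · exact absurd h0 hq0
      · linarith
    rcases (min_sq_eq_mul_iff (hw x) (hw y)).mp heq with e | e | e
    · exact e
    · exact absurd e (hwpos x hx).ne'
    · exact absurd e (hwpos y hy).ne'
  · intro h
    have hD : ∑ x, ∑ y, q x * q y * (weight p q x * weight p q y
        - min (weight p q x) (weight p q y) ^ 2) = 0 := by
      refine sum_eq_zero fun x _ => sum_eq_zero fun y _ => ?_
      have key : min (weight p q x) (weight p q y) ^ 2 = weight p q x * weight p q y := by
        refine (min_sq_eq_mul_iff (hw x) (hw y)).mpr ?_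
        by_cases hx : 0 < p x
        · by_cases hy : 0 < p y
          · exact Or.inl (h x y hx hy)
          · have : p y = 0 := le_antisymm (not_lt.mp hy) (hp y)
            exact Or.inr (Or.inr (by rw [weight, this, zero_div]))
        · have : p x = 0 := le_antisymm (not_lt.mp hx) (hp x)
          exact Or.inr (Or.inl (by rw [weight, this, zero_div]))
      rw [key, sub_self, mul_zero]
    have := one_sub_qq_min_weight_sq_eq hq hp1 (p := p)
    linarith

/-! ### What a hit-or-miss pair looks like: `h₁ = 𝟙_{p>0}`, `acc = ESS = q(p > 0)`, `m₁ = acc` -/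

/-- For a hit-or-miss pair the conditional mean is an indicator: `h₁(x) = Σ_y q_y min(w_x, w_y)` equals
`1` where `p x > 0` (there `min(w_x, w_y) = w_y` for every `y`, and `Σ_y q_y w_y = 1`) and `0` where
`p x = 0`. [ours] -/
theorem condMean_eq_ite_of_hitOrMiss {p q : X → ℝ}
    (hp : ∀ x, 0 ≤ p x) (hq : ∀ x, 0 < q x) (hp1 : ∑ x, p x = 1)
    (h : ∀ x y, 0 < p x → 0 < p y → weight p q x = weight p q y) (x : X) :
    ∑ y, q y * min (weight p q x) (weight p q y) = if 0 < p x then 1 else 0 := by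
  have hw : ∀ z, 0 ≤ weight p q z := fun z => div_nonneg (hp z) (hq z).le
  split_ifs with hx
  · rw [← sum_mul_weight hq hp1]
    refine sum_congr rfl fun y _ => ?_
    congr 1
    by_cases hy : 0 < p y
    · rw [h x y hx hy, min_self]
    · have hy0 : p y = 0 := le_antisymm (not_lt.mp hy) (hp y)
      have : weight p q y = 0 := by rw [weight, hy0, zero_div]
      rw [this]
      exact min_eq_right (hw x)
  · have hx0 : p x = 0 := le_antisymm (not_lt.mp hx) (hp x)
    have : weight p q x = 0 := by rw [weight, hx0, zero_div]
    refine sum_eq_zero fun y _ => ?_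
    rw [this, min_eq_left (hw y), mul_zero]

/-- **The weights of a hit-or-miss pair**: there is a level `c > 0` with `w = c·𝟙_{p>0}` and
`c · q(p > 0) = 1` (so `c = 1/q(p > 0)`). [ours] -/
theorem exists_weight_eq_ite_of_hitOrMiss {p q : X → ℝ} (hp : ∀ x, 0 ≤ p x) (hq : ∀ x, 0 < q x)
    (hp1 : ∑ x, p x = 1) (h : ∀ x y, 0 < p x → 0 < p y → weight p q x = weight p q y) :
    ∃ c : ℝ, 0 < c ∧ c * (∑ x ∈ univ.filter (fun x => 0 < p x), q x) = 1 ∧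
      ∀ x, weight p q x = if 0 < p x then c else 0 := by
  obtain ⟨x₀, -, hx₀⟩ : ∃ x₀ ∈ (univ : Finset X), 0 < p x₀ := by
    by_contra hne
    push Not at hne
    have : ∑ x, p x = 0 := sum_eq_zero fun x hx => le_antisymm (hne x hx) (hp x)
    rw [hp1] at this
    exact one_ne_zero this
  refine ⟨weight p q x₀, div_pos hx₀ (hq x₀), ?_, ?_⟩
  · rw [sum_filter, mul_sum, ← sum_mul_weight hq hp1]
    refine sum_congr rfl fun x _ => ?_
    split_ifs with hx
    · rw [h x x₀ hx hx₀, mul_comm]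
    · have hx0 : p x = 0 := le_antisymm (not_lt.mp hx) (hp x)
      rw [mul_zero, weight, hx0, zero_div, mul_zero]
  · intro x
    split_ifs with hx
    · exact h x x₀ hx hx₀
    · have hx0 : p x = 0 := le_antisymm (not_lt.mp hx) (hp x)
      rw [weight, hx0, zero_div]

/-- **`acc = q(p > 0)`**: the equilibrium acceptance of a hit-or-miss flow is the model mass of the
target's support. [ours] -/
theorem accRate_eq_modelMass_of_hitOrMiss {p q : X → ℝ} (hp : ∀ x, 0 ≤ p x) (hq : ∀ x, 0 < q x)
    (hp1 : ∑ x, p x = 1) (h : ∀ x y, 0 < p x → 0 < p y → weight p q x = weight p q y) :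
    accRate p q = ∑ x ∈ univ.filter (fun x => 0 < p x), q x := by
  rw [accRate_eq_qq_min_weight hq, sum_filter]
  refine sum_congr rfl fun x _ => ?_
  have e : ∑ y, q x * q y * min (weight p q x) (weight p q y)
      = q x * ∑ y, q y * min (weight p q x) (weight p q y) := by
    rw [mul_sum]
    exact sum_congr rfl fun y _ => by ring
  rw [e, condMean_eq_ite_of_hitOrMiss hp hq hp1 h x]
  split_ifs <;> simp

/-- **`m₁ = acc`** for a hit-or-miss pair (`h₁ ∈ {0, 1}` so `h₁² = h₁`). [ours] -/
theorem condMeanSq_eq_accRate_of_hitOrMiss {p q : X → ℝ} (hp : ∀ x, 0 ≤ p x) (hq : ∀ x, 0 < q x)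
    (hp1 : ∑ x, p x = 1) (h : ∀ x y, 0 < p x → 0 < p y → weight p q x = weight p q y) :
    ∑ x, q x * (∑ y, q y * min (weight p q x) (weight p q y)) ^ 2 = accRate p q := by
  rw [accRate_eq_modelMass_of_hitOrMiss hp hq hp1 h, sum_filter]
  refine sum_congr rfl fun x _ => ?_
  rw [condMean_eq_ite_of_hitOrMiss hp hq hp1 h x]
  split_ifs <;> simp

/-- **`ESS/N = acc = q(p > 0)`** for a hit-or-miss pair: with `w = c·𝟙_{p>0}`, `c·q(p>0) = 1`, one has
`E_q w = 1` and `E_q w² = c`, so `essFrac = 1/c = q(p > 0)`.  Hit-or-miss flows lie on the diagonal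
`acc = ESS` of the acceptance-vs-ESS plane. [ours] -/
theorem essFrac_eq_accRate_of_hitOrMiss {p q : X → ℝ} (hp : ∀ x, 0 ≤ p x) (hq : ∀ x, 0 < q x)
    (hp1 : ∑ x, p x = 1) (h : ∀ x y, 0 < p x → 0 < p y → weight p q x = weight p q y) :
    essFrac p q = accRate p q := by
  obtain ⟨c, hc, hcα, hwc⟩ := exists_weight_eq_ite_of_hitOrMiss hp hq hp1 h
  have h2 : ∑ x, q x * weight p q x ^ 2 = c := by
    calc ∑ x, q x * weight p q x ^ 2 = ∑ x, (if 0 < p x then q x else 0) * (c * c) := by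
          refine sum_congr rfl fun x _ => ?_
          rw [hwc x]
          split_ifs <;> ring
      _ = (∑ x ∈ univ.filter (fun x => 0 < p x), q x) * (c * c) := by rw [← sum_mul, sum_filter]
      _ = c := by
          calc (∑ x ∈ univ.filter (fun x => 0 < p x), q x) * (c * c)
              = (c * ∑ x ∈ univ.filter (fun x => 0 < p x), q x) * c := by ring
            _ = c := by rw [hcα, one_mul]
  rw [essFrac, sum_mul_weight hq hp1, h2, accRate_eq_modelMass_of_hitOrMiss hp hq hp1 h, one_pow]
  have hα : ∑ x ∈ univ.filter (fun x => 0 < p x), q x = 1 / c := by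
    field_simp
    linarith [hcα]
  rw [hα]

/-! ### The rigidity theorem -/

/-- **RIGIDITY OF THE ENVELOPE.**  For a normalised target `p ≥ 0`, a positive normalised model `q`
and every `n ≥ 2`: the variance of the pair-min acceptance statistic EQUALS the sharp envelope,
`E[(U − a)²] = (2(1 − a²) + 4(n − 2)·a(1 − a))/(n(n − 1))`, IF AND ONLY IF the pair is hit-or-miss
(all positive importance weights equal, i.e. `p = q(· | p > 0)`). [ours] -/
theorem variance_pairMin_eq_sharp_iff {p q : X → ℝ} (hp : ∀ x, 0 ≤ p x) (hq : ∀ x, 0 < q x)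
    (hp1 : ∑ x, p x = 1) (hq1 : ∑ x, q x = 1) (hn : 2 ≤ n) :
    ∑ φ : Fin n → X, blockProd (fun _ => q) φ
        * ((∑ z ∈ (univ : Finset (Fin n)).offDiag, min (weight p q (φ z.1)) (weight p q (φ z.2)))
            / (n * (n - 1)) - accRate p q) ^ 2
      = (2 * (1 - accRate p q ^ 2) + 4 * (n - 2) * (accRate p q * (1 - accRate p q)))
          / (n * (n - 1)) ↔
    ∀ x y, 0 < p x → 0 < p y → weight p q x = weight p q y := by
  rw [variance_pairMin_eq hq hq1 hn]
  have h2 : (2 : ℝ) ≤ n := by exact_mod_cast hn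
  have hNpos : (0 : ℝ) < n * (n - 1) := by
    have : (0 : ℝ) < n := by linarith
    have : (0 : ℝ) < n - 1 := by linarith
    positivity
  constructor
  · intro heq
    have hm2 := qq_min_weight_sq_le_one hp hq hp1
    have hm1 := condMean_sq_le_accRate hp hq hp1
    have h4 : (0 : ℝ) ≤ 4 * (n - 2) := by linarith
    rw [div_left_inj' hNpos.ne'] at heq
    have hprod := mul_le_mul_of_nonneg_left hm1 h4
    have hm2eq : ∑ x, ∑ y, q x * q y * min (weight p q x) (weight p q y) ^ 2 = 1 := by
      nlinarith
    exact (qq_min_weight_sq_eq_one_iff hp hq hp1).mp hm2eq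
  · intro h
    rw [(qq_min_weight_sq_eq_one_iff hp hq hp1).mpr h, condMeanSq_eq_accRate_of_hitOrMiss hp hq hp1 h]
    ring

/-- **STRICT inequality off the hit-or-miss family**: if two positive weights differ, the variance of
the pair-min statistic is STRICTLY below the envelope, at every `n ≥ 2`. [ours] -/
theorem variance_pairMin_lt_sharp {p q : X → ℝ} (hp : ∀ x, 0 ≤ p x) (hq : ∀ x, 0 < q x)
    (hp1 : ∑ x, p x = 1) (hq1 : ∑ x, q x = 1) (hn : 2 ≤ n)
    (hne : ∃ x y, 0 < p x ∧ 0 < p y ∧ weight p q x ≠ weight p q y) :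
    ∑ φ : Fin n → X, blockProd (fun _ => q) φ
        * ((∑ z ∈ (univ : Finset (Fin n)).offDiag, min (weight p q (φ z.1)) (weight p q (φ z.2)))
            / (n * (n - 1)) - accRate p q) ^ 2
      < (2 * (1 - accRate p q ^ 2) + 4 * (n - 2) * (accRate p q * (1 - accRate p q)))
          / (n * (n - 1)) := by
  refine lt_of_le_of_ne (variance_pairMin_le_sharp hp hq hp1 hq1 hn) fun heq => ?_
  obtain ⟨x, y, hx, hy, hxy⟩ := hne
  exact hxy ((variance_pairMin_eq_sharp_iff hp hq hp1 hq1 hn).mp heq x y hx hy)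

/-! ### The hit-or-miss pairs are the conditioned models `p = q(· | S)` -/

/-- **Hit-or-miss `↔` conditioned model**: all positive weights of `(p, q)` are equal iff
`p = q·𝟙_S / q(S)` for some set `S` (then `S ⊇` the support of `p`, with equality up to the
convention; the witness used is `S = {p > 0}`). [ours] -/
theorem hitOrMiss_iff_eq_condModel [DecidableEq X] {p q : X → ℝ} (hp : ∀ x, 0 ≤ p x)
    (hq : ∀ x, 0 < q x) (hp1 : ∑ x, p x = 1) :
    (∀ x y, 0 < p x → 0 < p y → weight p q x = weight p q y) ↔
      ∃ S : Finset X, ∀ x, p x = if x ∈ S then q x / ∑ y ∈ S, q y else 0 := by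
  constructor
  · intro h
    obtain ⟨c, hc, hcα, hwc⟩ := exists_weight_eq_ite_of_hitOrMiss hp hq hp1 h
    refine ⟨univ.filter (fun x => 0 < p x), fun x => ?_⟩
    have hα : ∑ y ∈ univ.filter (fun y => 0 < p y), q y = 1 / c := by
      field_simp
      linarith [hcα]
    rw [hα]
    simp only [mem_filter, mem_univ, true_and]
    split_ifs with hx
    · rw [← mul_weight (p := p) (hq x).ne', hwc x, if_pos hx]
      field_simp
    · exact le_antisymm (not_lt.mp hx) (hp x)
  · rintro ⟨S, hS⟩ x y hx hy
    have hxS : x ∈ S := by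
      by_contra hxS
      rw [hS x, if_neg hxS] at hx
      exact lt_irrefl _ hx
    have hyS : y ∈ S := by
      by_contra hyS
      rw [hS y, if_neg hyS] at hy
      exact lt_irrefl _ hy
    rw [weight, weight, hS x, hS y, if_pos hxS, if_pos hyS]
    field_simp [(hq x).ne', (hq y).ne']

end Rigidity

end Summit.Ventures.LatticeQCDFlow.Scoring
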